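import Summits.BirchSwinnertonDyer.Rank1Residual.Supersingular.X8KuriharaKP3OfferShape
import HarnessLib

/-!
# X7 at `p = 3` (N5@3 = X7 ∧ `r_an = 0`, O4@3 = X7 ∧ `r_an = 1`; surj(3)) PER-PAIR OFFER SHAPES: `BSD(E,3)` from the literal
# integer equation, a LANDED `CertifiedOddL` twist record + rounding certificate, KERNEL certificates for everything decidable
# (minimality, class X7 via an additive prime, surj(3), the cyclic Kolyvagin level from point counts + cube tests, the discrete
# logarithms), and EXACTLY the binders {Kim 2025 Thm 1.1 (OPEN), the published named facts, `D`, `r_an`, (`#Ш_an` in rank one),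
# the `L`-value enclosure}

Cell `b2b-bsdres`, supersingular family, X7 JOINT pair — B side (unit `b2b-bsdres-additive-p3`, gen 22; the `p = 3` Kurihara
consumers are B's, HOME/CLASS-OWNERS.md X7 row); companion of `X8KuriharaKP3OfferShape.lean` (same gen) and of prover A's
`X6KuriharaOfferShape.lean` (x10b gen 12).  Topic file; namespace `Summit.BirchSwinnertonDyer.Rank1Residual.Supersingular`.
THEOREMS ONLY (compositions of tree theorems by name); no named fact, no definition, nothing asserted about any curve,
nothing booked; X7 stays CONSTRUCTION-SHAPED (RESIDUAL-MAP §I N5 / O4 marks unchanged).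

HONEST FRAMING (run/shared/lean/b2b/bsd-rank1-residual/, verbatim in every file): the goal of the
cell is to DELETE the COMBINATION-SHAPED residual classes of the Birch–Swinnerton-Dyer formula for
ALL analytic-rank `≤ 1` elliptic curves over `ℚ` — "full BSD formula for every rank `≤ 1` curve in
class `C`" assembled STRICTLY from published theorems — so that the rank-`≤ 1` remainder becomes
exactly the CONSTRUCTION-SHAPED classes, which are TYPED (missing-input `Prop`s), NOT attempted.
This is not "finishing BSD".  EVERY theorem here is CONDITIONAL on the ANNOUNCED preprint C.-H. Kim
(app. R. Pollack), arXiv:2505.09121 Thm. 1.1 (`hK25s`, OPEN binder) — a typed OPEN hypothesis, never a theorem.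

## What this file proves

* §1 `X7RankOne.bsdp_iff_padicValRat_eq_zero_of_kim2025_OPEN_of_certifiedOddL_of_LValueBall` — the O4@3 twin of gen 21's
  `X8RankOne.…_of_certifiedOddL_of_LValueBall` (p306705): `BSD(E,3) ⟺ ord₃ #Ш_an = 0` from a LANDED prime-level `CertifiedOddL`
  row (`r.n = ℓ ∈ 𝒫₁`, cyclic `3`-part), its rounding certificate and the enclosure (prover A's
  `CertifiedOddL.kuriharaNumber_ne_zero_of_LValueBall` into `X7RankOne.…_of_kuriharaNumber_ne_zero_of_surj`).  `hCT`, `hGZK`,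
  `hmod` PUBLISHED; NO Manin / period / Tamagawa binder.
* §2 `X7.bsdp_three_rankZero_of_kim2025_OPEN_of_ainvs_of_certifiedOddL_of_LValueBall` — the N5@3 RECORD SHAPE (X7 ∧ `r_an = 0`):
  as the X8 shape of `X8KuriharaKP3OfferShape.lean` with class X7 read off the model by gen 20's `classX7_of_intModel` (`3 ∤ Δ`,
  `#Ẽ(𝔽₃) = n₃` with `3 ∣ 4 − n₃`, an ADDITIVE prime `q`: `q ∣ Δ`, `q ∣ c₄`), level `ℓ₁ℓ₂ ∈ 𝒩₁` cyclic by point counts + cube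
  tests, `A = Π(a_ℓ − 2)`; binders EXACTLY `hK25s` (OPEN), `hW`, `hGZK`, `hmod`, `h3per`, `D`, `r_an = 0`, `hballL`.
* §3 `X7RankOne.bsdp_three_of_kim2025_OPEN_of_ainvs_of_certifiedOddL_of_LValueBall` — the O4@3 RECORD SHAPE (X7 ∧ `r_an = 1`,
  `#Ш_an` a `3`-unit): PRIME level `ℓ ∈ 𝒫₁` (`ℓ ≥ 5`, `ℓ ∤ Δ`, `ℓ ≡ 1 (3)`, `#Ẽ(𝔽_ℓ) = m`, `3 ∣ m`, cube test), `A = ℓ + 1 − m − 2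
  = a_ℓ − 2`, one surjective discrete logarithm; binders EXACTLY `hK25s` (OPEN), `hCT`, `hGZK`, `hmod`, `D`, `r_an = 1`,
  `#Ш_an = q` with `ord₃ q = 0` (Cremona `allbsd`), `hballL`.  (On a row with `ord₃ #Ш_an > 0` a unit prime-level number would
  REFUTE `BSD(E,3)` modulo Kim 2025 by §1 — none occurs in the KP3 data, see the record files.)
Per pair; NOT class theorems; nothing booked (records built on these shapes are OFFERS for referee A).

References: `X8KuriharaKP3OfferShape.lean` (gen 22); `GoodSSTowerOfSurj.lean`, `RankZeroKimTamDefectRecords.lean` §1 (gen 21);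
`RankOneRem13NoCertificate.lean` (gen 20, `classX7_of_intModel`); `X6KuriharaOfferShape.lean`, `KuriharaTwistRecordGenericLValues.lean`,
`KuriharaTwistDlogChar.lean` (x10b gen 12); `Additive/X4ThreeKuriharaCertKernel.lean` (n1011-p03), `Additive/ThreeTorsionFullCubeDisc.lean`
(n1011-p15); [Kim2025RefinedTNC] Thm. 1.1 (ANNOUNCED); [Kim2022StructureSelmer] §1.2.2, §1.4.3; [Wuthrich2014] Lemma 20, Prop. 21;
[MazurTateTeitelbaum1986Invent] §I.8; [CremonaAlgorithms1997] §2.8; [SilvermanAEC2009] III.1, VII.1, VII.5, X.4.14; [IrelandRosen1990]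
Prop. 5.1.2; [Miller2011LMS] Def. 1.1.
-/

set_option autoImplicit false

noncomputable section

open scoped Classical MatrixGroups ModularForm

open CongruenceSubgroup WeierstrassCurve Literature.NumberTheory.EllipticCurves
  Literature.NumberTheory.EllipticCurves.ModularForms
  Literature.NumberTheory.EllipticCurves.Rank1Residual
  Literature.NumberTheory.EllipticCurves.Rank1Residual.Typed
  Literature.NumberTheory.EllipticCurves.Rank1Residual.X11RankOneCertificates
  Literature.NumberTheory.EllipticCurves.Wuthrich2014
  Summit.BirchSwinnertonDyer.BirchSwinnertonDyer.Rank1Residual.IntModel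
  Summit.BirchSwinnertonDyer.BirchSwinnertonDyer.Rank1Residual.X11RankOne
  Summit.BirchSwinnertonDyer.Rank1Residual.X11b
  Summit.BirchSwinnertonDyer.Rank1Residual.Additive
  Summit.BirchSwinnertonDyer.Rank1Residual.Supersingular.KuriharaTwist

namespace Summit.BirchSwinnertonDyer.Rank1Residual.Supersingular

/-- `3 ∣ ℓ − 1` from `ℓ ≡ 1 (mod 3^1)`. [folklore] -/
theorem three_dvd_sub_one_of_modEq_one {ℓ : ℕ} (h1 : ℓ ≡ 1 [MOD 3 ^ 1]) : 3 ∣ ℓ - 1 := by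
  have h3 : 1 ≡ ℓ [MOD 3] := (h1.of_dvd (dvd_refl _)).symm
  rcases Nat.eq_zero_or_pos ℓ with rfl | hpos
  · simp
  · exact (Nat.modEq_iff_dvd' hpos).mp h3

/-! ### §1 O4@3: down to a landed prime-level `CertifiedOddL` row + the enclosure -/

/-- **O4@3 = X7@3 ∧ `r_an = 1` ∧ surj(3): `BSD(E,3) ⟺ ord₃ #Ш_an = 0` from a LANDED prime-level `CertifiedOddL` row
(`r.p = 3`, `r.n = ℓ ∈ 𝒫₁` with cyclic `3`-part), its rounding certificate and an enclosure of the twisted `L`-value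
combination** (unit level) — the X7 twin of gen 21's `X8RankOne.…_of_certifiedOddL_of_LValueBall`.  CONDITIONAL on `hK25s`
(OPEN); `hCT`, `hGZK`, `hmod` PUBLISHED; NO Manin / period binder; X7 joint pair, B side.  Per pair; NOT a class theorem;
nothing booked. [claim: Kim2025RefinedTNC, status: under-review] [cite: Kim2025RefinedTNC, Thm. 1.1 (ANNOUNCED, OPEN binder)]
[cite: Kim2022StructureSelmer, §1.4.3 (PDF p. 7)] [cite: SilvermanAEC2009, Thm. X.4.14] [cite: Wuthrich2014, Lemma 20 (p. 399)]
[cite: MazurTateTeitelbaum1986Invent, §I.8 (8.6)] [cite: CremonaAlgorithms1997, §2.8 (2.8.8) (PDF p. 26)] [cite: Miller2011LMS, Def. 1.1] -/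
theorem X7RankOne.bsdp_iff_padicValRat_eq_zero_of_kim2025_OPEN_of_certifiedOddL_of_LValueBall
    (W : WeierstrassCurve ℚ) [W.IsElliptic] [W.IsGloballyMinimal]
    (hK25s : Kim2025.thm11_kimShaLength_of_integralPeriod_OPEN)
    (hCT : exists_casselsTate_pairing (K := ℚ))
    (hGZK : rank_eq_analyticRank_of_analyticRank_le_one) (hmod : hasEntireLFunction_rat)
    (hr : W.analyticRank = 1) (hX : ClassX7 W 3) (hs : Surj W 3)
    {N : ℕ} [NeZero N] (D : ModularParametrizationData W N)
    {rs : List TwistRecord} (hrs : CertifiedOddL rs) {r : TwistRecord} (hr' : r ∈ rs) [Fact r.p.Prime]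
    (hrp : r.p = 3) [hrn : Fact r.n.Prime] (hν : r.n.primeFactors.card = r.primes.length)
    (hℓ : Kato.IsKolyvaginPrime W r.p 1 r.n)
    (hcyc : Nat.card {P : ((WeierstrassCurve.integralModelInt W).map
        (Int.castRingHom (ZMod r.n))).toAffine.Point // r.p • P = 0} ≤ r.p)
    {cs : List RoundingCert} (hcs : RoundingCertifiedHasse cs) {c : RoundingCert} (hc : c ∈ cs)
    (hcp : c.p = r.p) (hcn : c.n = r.n) (hcden : c.den = r.den) (hcbins : c.bins = r.bins)
    (hD' : 0 < c.dstar)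
    (ψ : (ℓ : ℕ) → (ZMod ℓ)ˣ →* Multiplicative (ZMod (r.p ^ 1)))
    (hψ : Function.Surjective (ψ r.n))
    (hballL : ∀ (L : ZMod (r.p ^ 1) → ℂ → ℂ), (∀ j, j ≠ 0 → Differentiable ℂ (L j)) →
      (∀ j, j ≠ 0 → ∀ s : ℂ, 2 < s.re → L j s = twistedLSeries D.f (binChar r.n ψ j)⁻¹ s) →
      ∀ k < r.p, ∃ mid rad : ℝ, rad ≤ (c.radNum : ℝ) / 10 ^ c.radExp ∧
        |mid - ((c.binsStar.getD k 0 : ℤ) : ℝ)| ≤ (c.marNum : ℝ) / 10 ^ c.marExp ∧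
        |(c.dstar : ℝ) * ((r.components : ℝ) *
          (((∏ ℓ ∈ r.n.primeFactors, ((W.frobeniusTrace ℓ : ℂ) - 2)) * W.entireLFunction 1 +
            ∑ j ∈ (Finset.univ : Finset (ZMod (r.p ^ 1))).erase 0,
              ZMod.stdAddChar (-(j * (k : ZMod (r.p ^ 1)))) *
                (gaussSum (binChar r.n ψ j) (ZMod.stdAddChar (N := r.n)) * L j 1)).re /
            ((r.p ^ 1 : ℕ) * plusPeriod D.f))) - mid| ≤ rad)
    {q : ℚ} (hq : shaAn W = (q : ℂ)) : BSDp W 3 ↔ padicValRat 3 q = 0 := by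
  haveI : NeZero r.n := ⟨hrn.out.ne_zero⟩
  have hψ' : ∀ ℓ ∈ r.n.primeFactors, Function.Surjective (ψ ℓ) := fun ℓ hℓ' => by
    rw [hrn.out.primeFactors, Finset.mem_singleton] at hℓ'
    subst hℓ'
    exact hψ
  obtain ⟨lab, ai, cond, p', n', prs, rts, comp, rk, red, den, bins, dmp, ev⟩ := r
  dsimp only at hrp
  subst hrp
  have hne := CertifiedOddL.kuriharaNumber_ne_zero_of_LValueBall hrs hr' hν D.isNewformOf (by norm_num)
    (hasIrreducibleModPGaloisRep_of_hasSurjectiveModNGaloisRep W 3 hs) hX.1.1 hℓ.isKolyvaginProduct hcs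
    hc hcp hcn hcden hcbins hD' ψ hψ' hballL
  exact X7RankOne.bsdp_iff_padicValRat_eq_zero_of_kim2025_OPEN_of_kuriharaNumber_ne_zero_of_surj W hK25s
    hCT hGZK hmod hr hX hs D le_rfl (by norm_num) _ hℓ hcyc ψ hψ hne hq

/-! ### §2 N5@3: the literal-equation RECORD SHAPE in rank zero (level `ℓ₁ℓ₂ ∈ 𝒩₁`) -/

/-- **N5@3 RECORD SHAPE — `BSD(E,3)` on X7 ∧ `r_an = 0` ∧ surj(3) from the literal equation, a landed `CertifiedOddL`
twist record + rounding certificate, kernel certificates, and the `L`-value enclosure.**  As the X8 shape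
`X8RankZero.bsdp_three_of_kim2025_OPEN_of_ainvs_of_certifiedOddL_of_LValueBall` except for the class: X7 at `3` is read
off the model from `3 ∤ Δ`, `countPoints … 3 = n₃` with `3 ∣ 3 + 1 − n₃` (good supersingular) and an ADDITIVE prime `q`
(`q ∣ Δ`, `q ∣ c₄`; gen 20's `classX7_of_intModel`).  REMAINING HYPOTHESES = EXACTLY `hK25s` (OPEN), `hW`, `hGZK`, `hmod`,
`h3per` (PUBLISHED), `D`, `r_an = 0`, and `hballL`.  X7 joint pair, B side.  Per pair; NOT a class theorem; nothing booked.
[claim: Kim2025RefinedTNC, status: under-review] [cite: Kim2025RefinedTNC, Thm. 1.1 (ANNOUNCED, OPEN binder)]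
[cite: Kim2022StructureSelmer, §1.2.2 and §1.4.3 (PDF p. 7)] [cite: Wuthrich2014, Lemma 20 (p. 399) and Prop. 21 (p. 400)]
[cite: MazurTateTeitelbaum1986Invent, §I.8 (8.6)] [cite: CremonaAlgorithms1997, §2.8 (2.8.8) (PDF p. 26)]
[cite: SilvermanAEC2009, III.1, VII.1 Remark 1.1, VII.5 Prop. 5.1(a) and (c)] [cite: IrelandRosen1990, Prop. 5.1.2 and §8.1]
[cite: Miller2011LMS, Def. 1.1] -/
theorem X7.bsdp_three_rankZero_of_kim2025_OPEN_of_ainvs_of_certifiedOddL_of_LValueBall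
    (hK25s : Kim2025.thm11_kimShaLength_of_integralPeriod_OPEN) (hW : sha_dvd_analyticSha)
    (hGZK : rank_eq_analyticRank_of_analyticRank_le_one) (hmod : hasEntireLFunction_rat)
    (h3per : realPeriodRat_eq_unit_mul_plusPeriod_three)
    (a1 a2 a3 a4 a6 : ℤ) (hmin : (⟨a1, a2, a3, a4, a6⟩ : WeierstrassCurve ℚ).IsGloballyMinimal)
    (h3Δ : ¬ (3 : ℤ) ∣ discOf [a1, a2, a3, a4, a6]) {n₃ : ℕ}
    (hc₃ : countPoints [a1, a2, a3, a4, a6] 3 = n₃) (ha₃ : (3 : ℤ) ∣ (3 : ℤ) + 1 - n₃)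
    (q : ℕ) (hq : q.Prime) (hqΔ : (q : ℤ) ∣ discOf [a1, a2, a3, a4, a6]) (hqc₄ : (q : ℤ) ∣ c4Of [a1, a2, a3, a4, a6])
    (hsurj : Surj (⟨a1, a2, a3, a4, a6⟩ : WeierstrassCurve ℚ) 3)
    -- the landed twist record (`p = 3`, two level primes) and its rounding certificate
    {rs : List TwistRecord} (hrs : CertifiedOddL rs) {r : TwistRecord} (hr : r ∈ rs) [Fact r.p.Prime]
    (hrp : r.p = 3) (hν : r.primes.length = 2)
    {c : RoundingCert} (hcv : c.validHasse = true)
    (hcp : c.p = r.p) (hcn : c.n = r.n) (hcden : c.den = r.den) (hcbins : c.bins = r.bins) (hD' : 0 < c.dstar)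
    -- the cyclic Kolyvagin level `r.n = ℓ₁ · ℓ₂ ∈ 𝒩₁` from point counts and cube tests
    (ℓ₁ ℓ₂ : ℕ) (hne : ℓ₁ ≠ ℓ₂) (h5₁ : 5 ≤ ℓ₁) (h5₂ : 5 ≤ ℓ₂)
    (hΔ₁ : ¬ (ℓ₁ : ℤ) ∣ discOf [a1, a2, a3, a4, a6]) (hΔ₂ : ¬ (ℓ₂ : ℤ) ∣ discOf [a1, a2, a3, a4, a6])
    (h1₁ : ℓ₁ ≡ 1 [MOD 3 ^ 1]) (h1₂ : ℓ₂ ≡ 1 [MOD 3 ^ 1]) {m₁ m₂ : ℕ}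
    (hcnt₁ : Nat.card (((⟨a1, a2, a3, a4, a6⟩ : WeierstrassCurve ℤ).map
      (Int.castRingHom (ZMod ℓ₁))).toAffine.Point) = m₁)
    (hcnt₂ : Nat.card (((⟨a1, a2, a3, a4, a6⟩ : WeierstrassCurve ℤ).map
      (Int.castRingHom (ZMod ℓ₂))).toAffine.Point) = m₂)
    (hd₁ : 3 ^ 1 ∣ m₁) (hd₂ : 3 ^ 1 ∣ m₂)
    (hz₁ : ((discOf [a1, a2, a3, a4, a6] : ℤ) : ZMod ℓ₁) ≠ 0)
    (hχ₁ : ((discOf [a1, a2, a3, a4, a6] : ℤ) : ZMod ℓ₁) ^ ((ℓ₁ - 1) / 3) ≠ 1)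
    (hz₂ : ((discOf [a1, a2, a3, a4, a6] : ℤ) : ZMod ℓ₂) ≠ 0)
    (hχ₂ : ((discOf [a1, a2, a3, a4, a6] : ℤ) : ZMod ℓ₂) ^ ((ℓ₂ - 1) / 3) ≠ 1)
    [hℓ₁ : Fact ℓ₁.Prime] [hℓ₂ : Fact ℓ₂.Prime] [hrn0 : NeZero r.n] (hrn : ℓ₁ * ℓ₂ = r.n)
    {A : ℤ} (hA : A = ((ℓ₁ : ℤ) + 1 - m₁ - 2) * ((ℓ₂ : ℤ) + 1 - m₂ - 2))
    -- the discrete logarithms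
    (ψ₁ : (ZMod ℓ₁)ˣ →* Multiplicative (ZMod (r.p ^ 1))) (hψ₁ : Function.Surjective ψ₁)
    (ψ₂ : (ZMod ℓ₂)ˣ →* Multiplicative (ZMod (r.p ^ 1))) (hψ₂ : Function.Surjective ψ₂)
    -- data binders
    (hr0 : (⟨a1, a2, a3, a4, a6⟩ : WeierstrassCurve ℚ).analyticRank = 0)
    {N : ℕ} [NeZero N] (D : ModularParametrizationData (⟨a1, a2, a3, a4, a6⟩ : WeierstrassCurve ℚ) N)
    -- the engine's enclosure claim, through twisted L-values
    (hballL : ∀ (L : ZMod (r.p ^ 1) → ℂ → ℂ), (∀ j, j ≠ 0 → Differentiable ℂ (L j)) →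
      (∀ j, j ≠ 0 → ∀ s : ℂ, 2 < s.re →
        L j s = twistedLSeries D.f (binChar r.n (pairLogs ℓ₁ ℓ₂ ψ₁ ψ₂) j)⁻¹ s) →
      ∀ k < r.p, ∃ mid rad : ℝ, rad ≤ (c.radNum : ℝ) / 10 ^ c.radExp ∧
        |mid - ((c.binsStar.getD k 0 : ℤ) : ℝ)| ≤ (c.marNum : ℝ) / 10 ^ c.marExp ∧
        |(c.dstar : ℝ) * ((r.components : ℝ) *
          (((A : ℂ) * (⟨a1, a2, a3, a4, a6⟩ : WeierstrassCurve ℚ).entireLFunction 1 +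
            ∑ j ∈ (Finset.univ : Finset (ZMod (r.p ^ 1))).erase 0,
              ZMod.stdAddChar (-(j * (k : ZMod (r.p ^ 1)))) *
                (gaussSum (binChar r.n (pairLogs ℓ₁ ℓ₂ ψ₁ ψ₂) j) (ZMod.stdAddChar (N := r.n)) * L j 1)).re /
            ((r.p ^ 1 : ℕ) * plusPeriod D.f))) - mid| ≤ rad) :
    BSDp (⟨a1, a2, a3, a4, a6⟩ : WeierstrassCurve ℚ) 3 := by
  have h0 : discOf [a1, a2, a3, a4, a6] ≠ 0 := fun h ↦ h3Δ (by rw [h]; exact dvd_zero _)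
  haveI := isElliptic_of_discOf_ne_zero a1 a2 a3 a4 a6 h0
  haveI := hmin
  haveI : Fact (Nat.Prime 3) := ⟨by norm_num⟩
  have hI : integralModelInt (⟨a1, a2, a3, a4, a6⟩ : WeierstrassCurve ℚ) = ⟨a1, a2, a3, a4, a6⟩ :=
    integralModelInt_eq_of_map_eq _ (map_mk_int a1 a2 a3 a4 a6)
  have hΔ₁' : ((⟨a1, a2, a3, a4, a6⟩ : WeierstrassCurve ℤ).map (Int.castRingHom (ZMod ℓ₁))).Δ =
      ((discOf [a1, a2, a3, a4, a6] : ℤ) : ZMod ℓ₁) := by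
    rw [WeierstrassCurve.map_Δ, intCurve_Δ, eq_intCast]
  have hΔ₂' : ((⟨a1, a2, a3, a4, a6⟩ : WeierstrassCurve ℤ).map (Int.castRingHom (ZMod ℓ₂))).Δ =
      ((discOf [a1, a2, a3, a4, a6] : ℤ) : ZMod ℓ₂) := by
    rw [WeierstrassCurve.map_Δ, intCurve_Δ, eq_intCast]
  -- class X7 at `3`
  have hX : ClassX7 (⟨a1, a2, a3, a4, a6⟩ : WeierstrassCurve ℚ) 3 :=
    classX7_of_intModel (p := 3) hI (by rw [intCurve_Δ]; exact h3Δ)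
      (natCard_point_eq_of_countPoints a1 a2 a3 a4 a6 3 (by decide) h3Δ hc₃) ha₃ q hq
      (by rw [intCurve_Δ]; exact hqΔ) (by rw [intCurve_c₄]; exact hqc₄)
  -- the cyclic Kolyvagin level `ℓ₁ℓ₂ ∈ 𝒩₁`
  have hcyc3 : IsCyclicKolyvaginLevel (⟨a1, a2, a3, a4, a6⟩ : WeierstrassCurve ℚ) 3 (ℓ₁ * ℓ₂) :=
    isCyclicKolyvaginLevel_pair_of_intModel_of_cube hI (k := 1) le_rfl ℓ₁ ℓ₂ hne h5₁ h5₂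
      (by rw [intCurve_Δ]; exact hΔ₁) (by rw [intCurve_Δ]; exact hΔ₂) h1₁ h1₂ hcnt₁ hcnt₂ hd₁ hd₂
      (by rw [hΔ₁']; exact hz₁) (by rw [hΔ₁']; exact hχ₁) (by rw [hΔ₂']; exact hz₂) (by rw [hΔ₂']; exact hχ₂)
  have hcyc : IsCyclicKolyvaginLevel (⟨a1, a2, a3, a4, a6⟩ : WeierstrassCurve ℚ) r.p r.n := by
    rw [hrp, ← hrn]; exact hcyc3
  have hν' : r.n.primeFactors.card = r.primes.length := by
    rw [← hrn, hν, Nat.primeFactors_mul hℓ₁.out.ne_zero hℓ₂.out.ne_zero, hℓ₁.out.primeFactors,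
      hℓ₂.out.primeFactors, show ({ℓ₁} ∪ {ℓ₂} : Finset ℕ) = {ℓ₁, ℓ₂} from rfl, Finset.card_pair hne]
  have hψ : ∀ ℓ ∈ r.n.primeFactors, Function.Surjective (pairLogs ℓ₁ ℓ₂ ψ₁ ψ₂ ℓ) := by
    rw [← hrn]
    exact surjective_pairLogs_of_mem_primeFactors ψ₁ ψ₂ hℓ₁.out hℓ₂.out hne hψ₁ hψ₂
  have hcs : RoundingCertifiedHasse [c] :=
    (RoundingCertifiedHasse.cons_iff c []).2 ⟨hcv, RoundingCertifiedHasse.nil⟩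
  have hprod : (∏ ℓ ∈ r.n.primeFactors,
      (((⟨a1, a2, a3, a4, a6⟩ : WeierstrassCurve ℚ).frobeniusTrace ℓ : ℂ) - 2)) = (A : ℂ) := by
    rw [← hrn]; exact prod_primeFactors_frobeniusTrace_sub_two_eq hI hℓ₁.out hℓ₂.out hne hcnt₁ hcnt₂ hA
  refine X7.bsdp_three_rankZero_of_kim2025_OPEN_of_certifiedOddL_of_LValueBall _ hK25s hW hGZK hmod h3per hr0 hX
    hsurj D hrs hr hrp hν' hcyc hcs (List.mem_singleton_self c) hcp hcn hcden hcbins hD' (pairLogs ℓ₁ ℓ₂ ψ₁ ψ₂) hψ ?_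
  intro L hL hL' k hk
  obtain ⟨mid, rad, h1, h2, h3⟩ := hballL L hL hL' k hk
  refine ⟨mid, rad, h1, h2, ?_⟩
  rw [hprod]
  exact h3

/-! ### §3 O4@3: the literal-equation RECORD SHAPE in rank one (prime level `ℓ ∈ 𝒫₁`, `#Ш_an` a `3`-unit) -/

/-- `Π_{ℓ' ∣ ℓ} (a_{ℓ'}(E) − 2)` at a PRIME level from the point count, as the cast of an explicit integer. [folklore] -/
theorem prod_primeFactors_frobeniusTrace_sub_two_eq_of_prime {W : WeierstrassCurve ℚ} [W.IsElliptic]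
    [W.IsGloballyMinimal] {E₀ : WeierstrassCurve ℤ} (hI : integralModelInt W = E₀) {ℓ : ℕ} (hℓ : ℓ.Prime) {m : ℕ}
    (hc : Nat.card ((E₀.map (Int.castRingHom (ZMod ℓ))).toAffine.Point) = m) {A : ℤ}
    (hA : A = (ℓ : ℤ) + 1 - m - 2) :
    (∏ ℓ' ∈ (ℓ).primeFactors, ((W.frobeniusTrace ℓ' : ℂ) - 2)) = (A : ℂ) := by
  rw [hℓ.primeFactors, Finset.prod_singleton, frobeniusTrace_eq hI hc, hA]
  push_cast
  ring

/-- **O4@3 RECORD SHAPE — `BSD(E,3)` on X7 ∧ `r_an = 1` ∧ surj(3) ∧ `ord₃ #Ш_an = 0` from the literal equation, a landed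
PRIME-level `CertifiedOddL` twist record + rounding certificate, kernel certificates, and the `L`-value enclosure.**
`[a₁,…,a₆]` with `hmin`; decidable inputs: `3 ∤ Δ`, `countPoints … 3 = n₃` with `3 ∣ 4 − n₃`, an additive prime `q`
(`q ∣ Δ`, `q ∣ c₄`) (class X7); `hsurj` = gen 21's certificate; the landed `CertifiedOddL` row `r` (`r.p = 3`, ONE prime)
whose level `r.n = ℓ` is read off the model: `ℓ ≥ 5`, `ℓ ∤ Δ`, `ℓ ≡ 1 (mod 3)`, `#(E mod ℓ)(𝔽_ℓ) = m` with `3 ∣ m`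
(`ℓ ∈ 𝒫₁`, n1011-p03), cube test `(Δ : ℤ/ℓ) ≠ 0`, `(Δ : ℤ/ℓ)^{(ℓ−1)/3} ≠ 1` (cyclic `3`-part, n1011-p15) and
`A = ℓ + 1 − m − 2` (`= a_ℓ − 2`); a rounding certificate `c` passing `validHasse` and matching `r`; one surjective discrete
logarithm `ψ₁` (the family is `pairLogs ℓ ℓ ψ₁ ψ₁`).  REMAINING HYPOTHESES = EXACTLY `hK25s` (OPEN), `hCT`, `hGZK`, `hmod`
(PUBLISHED), `D`, `r_an = 1`, `#Ш_an = q` with `ord₃ q = 0` (Cremona `allbsd`), and `hballL`.  X7 joint pair, B side.  Per pair;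
NOT a class theorem; nothing booked. [claim: Kim2025RefinedTNC, status: under-review]
[cite: Kim2025RefinedTNC, Thm. 1.1 (ANNOUNCED, OPEN binder)] [cite: Kim2022StructureSelmer, §1.2.2 and §1.4.3 (PDF p. 7)]
[cite: SilvermanAEC2009, III.1, VII.1 Remark 1.1, VII.5 Prop. 5.1(a) and (c), Thm. X.4.14] [cite: Wuthrich2014, Lemma 20 (p. 399)]
[cite: MazurTateTeitelbaum1986Invent, §I.8 (8.6)] [cite: CremonaAlgorithms1997, §2.8 (2.8.8) (PDF p. 26)]
[cite: IrelandRosen1990, Prop. 5.1.2 and §8.1] [cite: Miller2011LMS, Def. 1.1] -/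
theorem X7RankOne.bsdp_three_of_kim2025_OPEN_of_ainvs_of_certifiedOddL_of_LValueBall
    (hK25s : Kim2025.thm11_kimShaLength_of_integralPeriod_OPEN)
    (hCT : exists_casselsTate_pairing (K := ℚ))
    (hGZK : rank_eq_analyticRank_of_analyticRank_le_one) (hmod : hasEntireLFunction_rat)
    (a1 a2 a3 a4 a6 : ℤ) (hmin : (⟨a1, a2, a3, a4, a6⟩ : WeierstrassCurve ℚ).IsGloballyMinimal)
    (h3Δ : ¬ (3 : ℤ) ∣ discOf [a1, a2, a3, a4, a6]) {n₃ : ℕ}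
    (hc₃ : countPoints [a1, a2, a3, a4, a6] 3 = n₃) (ha₃ : (3 : ℤ) ∣ (3 : ℤ) + 1 - n₃)
    (q : ℕ) (hq : q.Prime) (hqΔ : (q : ℤ) ∣ discOf [a1, a2, a3, a4, a6]) (hqc₄ : (q : ℤ) ∣ c4Of [a1, a2, a3, a4, a6])
    (hsurj : Surj (⟨a1, a2, a3, a4, a6⟩ : WeierstrassCurve ℚ) 3)
    -- the landed twist record (`p = 3`, one level prime) and its rounding certificate
    {rs : List TwistRecord} (hrs : CertifiedOddL rs) {r : TwistRecord} (hr : r ∈ rs) [Fact r.p.Prime]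
    (hrp : r.p = 3) (hν : r.primes.length = 1)
    {c : RoundingCert} (hcv : c.validHasse = true)
    (hcp : c.p = r.p) (hcn : c.n = r.n) (hcden : c.den = r.den) (hcbins : c.bins = r.bins) (hD' : 0 < c.dstar)
    -- the cyclic Kolyvagin prime `r.n = ℓ ∈ 𝒫₁` from the point count and the cube test
    (ℓ : ℕ) (h5 : 5 ≤ ℓ) (hΔℓ : ¬ (ℓ : ℤ) ∣ discOf [a1, a2, a3, a4, a6]) (h1 : ℓ ≡ 1 [MOD 3 ^ 1]) {m : ℕ}
    (hcnt : Nat.card (((⟨a1, a2, a3, a4, a6⟩ : WeierstrassCurve ℤ).map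
      (Int.castRingHom (ZMod ℓ))).toAffine.Point) = m)
    (hd : 3 ^ 1 ∣ m)
    (hz : ((discOf [a1, a2, a3, a4, a6] : ℤ) : ZMod ℓ) ≠ 0)
    (hχ : ((discOf [a1, a2, a3, a4, a6] : ℤ) : ZMod ℓ) ^ ((ℓ - 1) / 3) ≠ 1)
    [hℓ : Fact ℓ.Prime] [hrn : Fact r.n.Prime] (hrn' : ℓ = r.n)
    {A : ℤ} (hA : A = (ℓ : ℤ) + 1 - m - 2)
    -- the discrete logarithm
    (ψ₁ : (ZMod ℓ)ˣ →* Multiplicative (ZMod (r.p ^ 1))) (hψ₁ : Function.Surjective ψ₁)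
    -- data binders
    (hr1 : (⟨a1, a2, a3, a4, a6⟩ : WeierstrassCurve ℚ).analyticRank = 1)
    {N : ℕ} [NeZero N] (D : ModularParametrizationData (⟨a1, a2, a3, a4, a6⟩ : WeierstrassCurve ℚ) N)
    {s : ℚ} (hs : shaAn (⟨a1, a2, a3, a4, a6⟩ : WeierstrassCurve ℚ) = (s : ℂ)) (hv : padicValRat 3 s = 0)
    -- the engine's enclosure claim, through twisted L-values
    (hballL : ∀ (L : ZMod (r.p ^ 1) → ℂ → ℂ), (∀ j, j ≠ 0 → Differentiable ℂ (L j)) →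
      (∀ j, j ≠ 0 → ∀ s : ℂ, 2 < s.re →
        L j s = twistedLSeries D.f (binChar r.n (pairLogs ℓ ℓ ψ₁ ψ₁) j)⁻¹ s) →
      ∀ k < r.p, ∃ mid rad : ℝ, rad ≤ (c.radNum : ℝ) / 10 ^ c.radExp ∧
        |mid - ((c.binsStar.getD k 0 : ℤ) : ℝ)| ≤ (c.marNum : ℝ) / 10 ^ c.marExp ∧
        |(c.dstar : ℝ) * ((r.components : ℝ) *
          (((A : ℂ) * (⟨a1, a2, a3, a4, a6⟩ : WeierstrassCurve ℚ).entireLFunction 1 +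
            ∑ j ∈ (Finset.univ : Finset (ZMod (r.p ^ 1))).erase 0,
              ZMod.stdAddChar (-(j * (k : ZMod (r.p ^ 1)))) *
                (gaussSum (binChar r.n (pairLogs ℓ ℓ ψ₁ ψ₁) j) (ZMod.stdAddChar (N := r.n)) * L j 1)).re /
            ((r.p ^ 1 : ℕ) * plusPeriod D.f))) - mid| ≤ rad) :
    BSDp (⟨a1, a2, a3, a4, a6⟩ : WeierstrassCurve ℚ) 3 := by
  have h0 : discOf [a1, a2, a3, a4, a6] ≠ 0 := fun h ↦ h3Δ (by rw [h]; exact dvd_zero _)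
  haveI := isElliptic_of_discOf_ne_zero a1 a2 a3 a4 a6 h0
  haveI := hmin
  haveI : Fact (Nat.Prime 3) := ⟨by norm_num⟩
  have hI : integralModelInt (⟨a1, a2, a3, a4, a6⟩ : WeierstrassCurve ℚ) = ⟨a1, a2, a3, a4, a6⟩ :=
    integralModelInt_eq_of_map_eq _ (map_mk_int a1 a2 a3 a4 a6)
  have hΔ' : ((⟨a1, a2, a3, a4, a6⟩ : WeierstrassCurve ℤ).map (Int.castRingHom (ZMod ℓ))).Δ =
      ((discOf [a1, a2, a3, a4, a6] : ℤ) : ZMod ℓ) := by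
    rw [WeierstrassCurve.map_Δ, intCurve_Δ, eq_intCast]
  -- class X7 at `3`
  have hX : ClassX7 (⟨a1, a2, a3, a4, a6⟩ : WeierstrassCurve ℚ) 3 :=
    classX7_of_intModel (p := 3) hI (by rw [intCurve_Δ]; exact h3Δ)
      (natCard_point_eq_of_countPoints a1 a2 a3 a4 a6 3 (by decide) h3Δ hc₃) ha₃ q hq
      (by rw [intCurve_Δ]; exact hqΔ) (by rw [intCurve_c₄]; exact hqc₄)
  -- the Kolyvagin prime and the cyclicity of the `3`-part
  have hK3 : Kato.IsKolyvaginPrime (⟨a1, a2, a3, a4, a6⟩ : WeierstrassCurve ℚ) 3 1 ℓ :=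
    isKolyvaginPrime_of_intModel_of_card hI 3 1 ℓ (by omega) (by rw [intCurve_Δ]; exact hΔℓ) h1 hcnt hd
  have hcyc3 : Nat.card {P : ((WeierstrassCurve.integralModelInt (⟨a1, a2, a3, a4, a6⟩ : WeierstrassCurve ℚ)).map
      (Int.castRingHom (ZMod ℓ))).toAffine.Point // 3 • P = 0} ≤ 3 :=
    card_three_torsion_le_of_intModel_of_pow_div_three_ne_one hI ℓ (by rw [hΔ']; exact hz) (by rw [hΔ']; exact hχ) h5
      (three_dvd_sub_one_of_modEq_one h1)
  -- from here on the level is written `r.n` (substitute the variable `ℓ := r.n` everywhere)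
  subst hrn'
  have hK : Kato.IsKolyvaginPrime (⟨a1, a2, a3, a4, a6⟩ : WeierstrassCurve ℚ) r.p 1 r.n := by rw [hrp]; exact hK3
  have hcyc : Nat.card {P : ((WeierstrassCurve.integralModelInt (⟨a1, a2, a3, a4, a6⟩ : WeierstrassCurve ℚ)).map
      (Int.castRingHom (ZMod r.n))).toAffine.Point // r.p • P = 0} ≤ r.p := by rw [hrp]; exact hcyc3
  have hν' : r.n.primeFactors.card = r.primes.length := by rw [hν, hℓ.out.primeFactors, Finset.card_singleton]
  have hψ : Function.Surjective (pairLogs r.n r.n ψ₁ ψ₁ r.n) := by rw [pairLogs_apply_right]; exact hψ₁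
  have hcs : RoundingCertifiedHasse [c] :=
    (RoundingCertifiedHasse.cons_iff c []).2 ⟨hcv, RoundingCertifiedHasse.nil⟩
  have hprod : (∏ ℓ' ∈ r.n.primeFactors,
      (((⟨a1, a2, a3, a4, a6⟩ : WeierstrassCurve ℚ).frobeniusTrace ℓ' : ℂ) - 2)) = (A : ℂ) :=
    prod_primeFactors_frobeniusTrace_sub_two_eq_of_prime hI hℓ.out hcnt hA
  rw [X7RankOne.bsdp_iff_padicValRat_eq_zero_of_kim2025_OPEN_of_certifiedOddL_of_LValueBall _ hK25s hCT hGZK hmod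
    hr1 hX hsurj D hrs hr hrp hν' hK hcyc hcs (List.mem_singleton_self c) hcp hcn hcden hcbins hD'
    (pairLogs r.n r.n ψ₁ ψ₁) hψ ?_ hs]
  · exact hv
  intro L hL hL' k hk
  obtain ⟨mid, rad, h1', h2, h3⟩ := hballL L hL hL' k hk
  refine ⟨mid, rad, h1', h2, ?_⟩
  rw [hprod]
  exact h3

end Summit.BirchSwinnertonDyer.Rank1Residual.Supersingular

end
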